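import Summits.BirchSwinnertonDyer.BirchSwinnertonDyer.Theorems.ManinLocalTwoThreeEtaLimitsSixtyFour
import Summits.BirchSwinnertonDyer.BirchSwinnertonDyer.Theorems.ManinLocalTwoThreeNewformSixtyFour
import HarnessLib

/-!
# The `η`-identities of `X₀(64) → 64a1` EXACTLY: `y² = X³ − 4X`, `X′ = −2πiφ₆₄·2y`, `y′ = −2πiφ₆₄(3X² − 4)`,
# and (S2)₆₄: `Λ(φ₆₄) ⊆ Λ(16, 0)` — the Néron lattice of `64a1 : y² = x³ − 4x` — unconditionally

Cell bsd-f2-manin, route `ManinLocalTwoThree` (crux C2 `ManinOddAtFour` stmt-22967: `2² ∣ 64`; the first genus-THREE level of the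
domain), prover seat p3 gen 23.  Objects: `X = η₁₆⁶/(η₈²η₃₂⁴)` (the tree's level-`32` coordinate), `y = η₄²η₁₆⁴/(η₈²η₃₂⁴)`,
`φ₆₄ = η₈⁸/(η₄²η₁₆²)` (the newform of `64a1`, an `η`-quotient; here the cusp form `etaQuotientCuspForm 64 … 2`).

* §1 **(I1)₆₄ `y² = X³ − 4X` on `ℍ`, EXACTLY** — by WEIGHT ZERO, not by Sturm: `y² = η₄⁴η₁₆⁸/(η₈⁴η₃₂⁸)` is a LEVEL-`32`
  Newman quotient, so `F = y² − X³ + 4X` is a holomorphic `Γ₀(32)`-invariant function, bounded at every cusp of `X₀(32)` off `∞`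
  (Ligozat orders) and tending to `0` at `∞` ((T3)₆₄); it is a weight-`0` modular form, hence constant
  (`ModularForm.eq_const_of_weight_zero`), hence `0`.
* §2 **(I2b)₆₄ `y′ = −2πiφ₆₄(3X² − 4)`** — ALGEBRA: differentiate (I1) and substitute (I2a)₆₄ `X′ = −2πiφ₆₄·2y`
  (`EtaLimitsSixtyFour.deriv_X_sixtyFour`, itself the level-`32` identity since `φ₆₄y = φ₃₂Y₃₂`), cancel `2y ≠ 0`.
  (So at level `64` NO cusp-form/Sturm argument is needed for the identities; (T1)/(T2) of the limits file remain as checks.)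
* §3 **(S2)₆₄**: `(X′)² = (2πiφ₆₄)²(4X³ − 16X)` on `ℍ`, `X` is `Γ₀(64)`-invariant and non-degenerate, so by the analytic bridge
  (`AnalyticBridge.periodLattice_le_of_deriv_sq`) every period of `φ₆₄` lies in the Weierstrass lattice with invariants
  `(g₂, g₃) = (16, 0) = (c₄/12, c₆/216)` of `64a1 = [0, 0, 0, −4, 0]`.

NOT here (next files): the pinning of `D.f` at level `64` (`S₂(Γ₀(64)) = ⟨φ₃₂, φ₃₂(2τ), φ₆₄⟩`, `U₂`/`T₅`), the minimality of
`[0, 0, 0, ∓4, 0]`, and the Néron squeeze giving `|c| = 1` on `X₀(64)`.  Nothing here proves C2, Manin's conjecture or BSD; items OPEN.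
[cite: Ligozat1975, Ch. 3] [cite: MartinOno1997, Thm. 2] [cite: CremonaAlgorithms1997, §2.10 and Table 1 (64a1)]
-/

set_option autoImplicit false
set_option linter.dupNamespace false

noncomputable section

open Complex Filter Topology Set Asymptotics
open UpperHalfPlane hiding I
open scoped Real Topology Manifold MatrixGroups ModularForm
open ModularForm CongruenceSubgroup
open Literature.NumberTheory.EllipticCurves Literature.NumberTheory.EllipticCurves.ModularForms

namespace Summit.BirchSwinnertonDyer.BirchSwinnertonDyer.Theorems.ManinLocalTwoThree.EtaIdentitiesSixtyFour

open QRemainder EulerRemainders EulerRemaindersThirtyTwo EulerRemaindersSixtyFour EtaLimitsSixtyFour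
open CuspToolkit EtaIdentityReduction EtaIdentityReductionThirtyTwo AnalyticBridge

/-! ## §1 (I1)₆₄ `y² = X³ − 4X` exactly, by weight zero on `Γ₀(32)` -/

/-- **`y² = η₄⁴η₁₆⁸/(η₈⁴η₃₂⁸) = E₄⁴E₁₆⁸/(q⁶E₈⁴E₃₂⁸)`** as a level-`32` `η`-quotient. [folklore] -/
theorem Ysq_eq (τ : ℍ) :
    etaQuotient 32 (expFn [(4, 4), (8, -4), (16, 8), (32, -8)]) τ
      = eulerFn 4 τ ^ 4 * eulerFn 16 τ ^ 8
        / (Function.Periodic.qParam 1 (τ : ℂ) ^ 6 * eulerFn 8 τ ^ 4 * eulerFn 32 τ ^ 8) := by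
  have hE8 := eulerFn_ne_zero (by norm_num : 0 < 8) τ
  have hE32 := eulerFn_ne_zero (by norm_num : 0 < 32) τ
  have hq := qParam_ne_zero τ
  rw [etaQuotient_eq_cexp_mul_prod, show Nat.divisors 32 = {1, 2, 4, 8, 16, 32} by decide]
  have hsum : (∑ δ ∈ ({1, 2, 4, 8, 16, 32} : Finset ℕ),
      (δ : ℤ) * expFn [(4, 4), (8, -4), (16, 8), (32, -8)] δ) = (-(24 * 6 : ℕ) : ℤ) := by decide
  rw [hsum, cexp_neg_eq_inv_qParam_pow]
  rw [Finset.prod_insert (by decide), Finset.prod_insert (by decide), Finset.prod_insert (by decide),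
    Finset.prod_insert (by decide), Finset.prod_insert (by decide), Finset.prod_singleton]
  rw [show expFn [(4, 4), (8, -4), (16, 8), (32, -8)] 1 = 0 by decide,
    show expFn [(4, 4), (8, -4), (16, 8), (32, -8)] 2 = 0 by decide,
    show expFn [(4, 4), (8, -4), (16, 8), (32, -8)] 4 = 4 by decide,
    show expFn [(4, 4), (8, -4), (16, 8), (32, -8)] 8 = -4 by decide,
    show expFn [(4, 4), (8, -4), (16, 8), (32, -8)] 16 = 8 by decide,
    show expFn [(4, 4), (8, -4), (16, 8), (32, -8)] 32 = -8 by decide]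
  simp only [zpow_neg, zpow_ofNat]
  field_simp

/-- `y₆₄² = ` the level-`32` quotient `η₄⁴η₁₆⁸/(η₈⁴η₃₂⁸)`. [folklore] -/
theorem y64_sq (τ : ℍ) :
    etaQuotient 64 (expFn [(4, 2), (8, -2), (16, 4), (32, -4)]) τ ^ 2
      = etaQuotient 32 (expFn [(4, 4), (8, -4), (16, 8), (32, -8)]) τ := by
  have hE8 := eulerFn_ne_zero (by norm_num : 0 < 8) τ
  have hE32 := eulerFn_ne_zero (by norm_num : 0 < 32) τ
  have hq := qParam_ne_zero τ
  rw [y64_eq, Ysq_eq]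
  field_simp

/-- Newman's conditions for `η₄⁴η₁₆⁸/(η₈⁴η₃₂⁸)` at level `32`, weight `0` (`∏ δ^{|r|} = 2⁹² = (2⁴⁶)²`). [folklore] -/
theorem newmanCond_Ysq : NewmanCond 32 (expFn [(4, 4), (8, -4), (16, 8), (32, -8)]) 0 :=
  ⟨by decide, by decide, by decide, ⟨2 ^ 46, by decide⟩⟩

/-- `y²` is `Γ₀(32)`-invariant. [folklore] -/
theorem Ysq_smul (γ : Gamma0 32) (τ : ℍ) :
    etaQuotient 32 (expFn [(4, 4), (8, -4), (16, 8), (32, -8)]) ((γ : SL(2, ℤ)) • τ)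
      = etaQuotient 32 (expFn [(4, 4), (8, -4), (16, 8), (32, -8)]) τ := by
  simpa using etaQuotient_smul_of_mem_Gamma0 32 (by norm_num) (expFn [(4, 4), (8, -4), (16, 8), (32, -8)]) 0
    Even.zero newmanCond_Ysq γ.2 τ

/-- `y² ∘ γ` is bounded at `i∞` for `γ ∉ Γ₀(32)` (Ligozat orders `≥ 0` at the cusps `1, 1/2, 1/4, 1/8, 1/16`). [cite: Ligozat1975, Ch. 3] -/
theorem isBoundedAtImInfty_Ysq_smul {γ : SL(2, ℤ)} (hγ : γ ∉ Gamma0 32) :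
    IsBoundedAtImInfty (fun τ : ℍ ↦ etaQuotient 32 (expFn [(4, 4), (8, -4), (16, 8), (32, -8)]) (γ • τ)) :=
  isBoundedAtImInfty_etaQuotient_smul 32 (by norm_num) _ (by decide) γ
    (cuspOrder24_nonneg_of_not_dvd32 _ (by decide) (by decide) (by decide) (by decide) (by decide)
      (not_dvd_of_not_mem32 hγ))

/-- **(I1)₆₄: `y² = X³ − 4X` on `ℍ`, exactly.**  `F = y² − X³ + 4X` is a weight-`0` modular form on `Γ₀(32)` (holomorphic,
invariant, bounded at every cusp; at `∞` it tends to `0` by (T3)₆₄), hence constant, hence `0`. [cite: Ligozat1975, Ch. 3] -/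
theorem cubic_sixtyFour (τ : ℍ) :
    etaQuotient 64 (expFn [(4, 2), (8, -2), (16, 4), (32, -4)]) τ ^ 2
      = etaQuotient 32 (expFn [(8, -2), (16, 6), (32, -4)]) τ ^ 3
        - 4 * etaQuotient 32 (expFn [(8, -2), (16, 6), (32, -4)]) τ := by
  set F : ℍ → ℂ := fun σ ↦ etaQuotient 32 (expFn [(4, 4), (8, -4), (16, 8), (32, -8)]) σ
    - etaQuotient 32 (expFn [(8, -2), (16, 6), (32, -4)]) σ ^ 3
    + 4 * etaQuotient 32 (expFn [(8, -2), (16, 6), (32, -4)]) σ with hF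
  -- `F → 0` at `i∞` ((T3)₆₄ with `y² = η₄⁴η₁₆⁸/(η₈⁴η₃₂⁸)`)
  have hF0 : Tendsto F atImInfty (𝓝 0) := by
    have h := tendsto_T3.neg
    rw [neg_zero] at h
    refine h.congr fun σ ↦ ?_
    simp only [hF]
    rw [y64_sq σ]
    ring
  -- invariance and boundedness
  have hFsmul : ∀ γ : SL(2, ℤ), γ ∈ Gamma0 32 → ∀ σ : ℍ, F (γ • σ) = F σ := fun γ hγ σ ↦ by
    simp only [hF, X_smul ⟨γ, hγ⟩ σ, Ysq_smul ⟨γ, hγ⟩ σ]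
  have hslash0 : ∀ γ : SL(2, ℤ), F ∣[(0 : ℤ)] γ = fun σ ↦ F (γ • σ) := fun γ ↦ by
    funext σ
    rw [SL_slash_apply, neg_zero, zpow_zero, mul_one]
  have hFslash : ∀ γ : SL(2, ℤ), γ ∈ Gamma0 32 → F ∣[(0 : ℤ)] γ = F := fun γ hγ ↦ by
    rw [hslash0 γ]
    funext σ
    exact hFsmul γ hγ σ
  have hFmd : MDifferentiable 𝓘(ℂ) 𝓘(ℂ) F := by
    have h := ((mdifferentiable_etaQuotient 32 (expFn [(4, 4), (8, -4), (16, 8), (32, -8)])).sub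
      ((mdifferentiable_etaQuotient 32 (expFn [(8, -2), (16, 6), (32, -4)])).pow 3)).add
      ((mdifferentiable_etaQuotient 32 (expFn [(8, -2), (16, 6), (32, -4)])).const_smul (4 : ℂ))
    convert h using 1
    funext σ
    simp only [hF, Pi.add_apply, Pi.sub_apply, Pi.pow_apply, Pi.smul_apply, smul_eq_mul]
  have hFbdd : ∀ γ : SL(2, ℤ), IsBoundedAtImInfty (F ∣[(0 : ℤ)] γ) := by
    intro γ
    by_cases hγ : γ ∈ Gamma0 32
    · rw [hFslash γ hγ]
      exact Filter.ZeroAtFilter.boundedAtFilter hF0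
    · rw [hslash0 γ]
      exact (((isBoundedAtImInfty_Ysq_smul hγ).sub
        (((isBoundedAtImInfty_X_smul hγ).mul (isBoundedAtImInfty_X_smul hγ)).mul
          (isBoundedAtImInfty_X_smul hγ))).add ((isBoundedAtImInfty_X_smul hγ).const_mul_left 4)).congr_left
        fun σ ↦ by simp only [hF, Pi.mul_apply]; ring
  -- the weight-0 modular form
  let Fm : ModularForm (Gamma0 32) 0 :=
    { toFun := F
      slash_action_eq' := fun A hA ↦ by
        obtain ⟨γ, hγ, rfl⟩ := hA
        exact hFslash γ hγ
      holo' := hFmd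
      bdd_at_cusps' := fun {c} hc ↦ by
        rw [Subgroup.IsArithmetic.isCusp_iff_isCusp_SL2Z] at hc
        rw [OnePoint.isBoundedAt_iff_forall_SL2Z hc]
        intro γ _
        exact hFbdd γ }
  obtain ⟨c, hc⟩ := ModularForm.eq_const_of_weight_zero Fm
  have hc' : F = Function.const ℍ c := hc
  have hc0 : c = 0 := by
    rw [hc'] at hF0
    exact tendsto_const_nhds_iff.mp hF0
  have hFτ : F τ = 0 := by rw [hc', hc0]; rfl
  rw [y64_sq τ]
  have h' : etaQuotient 32 (expFn [(4, 4), (8, -4), (16, 8), (32, -8)]) τ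
      - etaQuotient 32 (expFn [(8, -2), (16, 6), (32, -4)]) τ ^ 3
      + 4 * etaQuotient 32 (expFn [(8, -2), (16, 6), (32, -4)]) τ = 0 := hFτ
  linear_combination h'

/-! ## §2 (I2b)₆₄ `y′ = −2πiφ₆₄(3X² − 4)` by differentiating (I1)₆₄ -/

/-- **(I2b)₆₄: `y′ = −2πi φ₆₄ · (3X² − 4)`** on `ℍ`: differentiate `y² = X³ − 4X`, substitute `X′ = −2πiφ₆₄·2y`, cancel
`2y ≠ 0` (`η`-quotients do not vanish on `ℍ`). [cite: Ligozat1975, Ch. 3] -/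
theorem deriv_y_sixtyFour (τ : ℍ) :
    deriv (etaQuotient 64 (expFn [(4, 2), (8, -2), (16, 4), (32, -4)]) ∘ ofComplex) τ
      = -(2 * π * I * etaQuotient 64 (expFn [(4, -2), (8, 8), (16, -2)]) τ)
          * (3 * etaQuotient 32 (expFn [(8, -2), (16, 6), (32, -4)]) τ ^ 2 - 4) := by
  set X : ℍ → ℂ := etaQuotient 32 (expFn [(8, -2), (16, 6), (32, -4)]) with hX
  set Y : ℍ → ℂ := etaQuotient 64 (expFn [(4, 2), (8, -2), (16, 4), (32, -4)]) with hY
  have hXd := UpperHalfPlane.mdifferentiable_iff.mp (mdifferentiable_etaQuotient 32 (expFn [(8, -2), (16, 6), (32, -4)]))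
  have hYd := UpperHalfPlane.mdifferentiable_iff.mp
    (mdifferentiable_etaQuotient 64 (expFn [(4, 2), (8, -2), (16, 4), (32, -4)]))
  have hτ : (τ : ℂ) ∈ {z : ℂ | 0 < z.im} := τ.im_pos
  have h1 : HasDerivAt (X ∘ ofComplex) (deriv (X ∘ ofComplex) τ) τ :=
    ((hXd τ hτ).differentiableAt (isOpen_upperHalfPlaneSet.mem_nhds hτ)).hasDerivAt
  have h2 : HasDerivAt (Y ∘ ofComplex) (deriv (Y ∘ ofComplex) τ) τ :=
    ((hYd τ hτ).differentiableAt (isOpen_upperHalfPlaneSet.mem_nhds hτ)).hasDerivAt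
  -- `G = Y² − X³ + 4X` vanishes on the upper half-plane, so its derivative at `τ` is `0`
  have hG : (fun z : ℂ ↦ (Y ∘ ofComplex) z ^ 2 - (X ∘ ofComplex) z ^ 3 + 4 * (X ∘ ofComplex) z)
      =ᶠ[𝓝 (τ : ℂ)] fun _ ↦ 0 := by
    filter_upwards [isOpen_upperHalfPlaneSet.mem_nhds hτ] with z hz
    simp only [Function.comp_apply, ofComplex_apply_of_im_pos hz, hX, hY, cubic_sixtyFour]
    ring
  have hG' := ((h2.fun_pow 2).fun_sub (h1.fun_pow 3)).fun_add (h1.const_mul 4)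
  have hzero : (2 : ℕ) * (Y ∘ ofComplex) τ ^ (2 - 1) * deriv (Y ∘ ofComplex) τ
      - (3 : ℕ) * (X ∘ ofComplex) τ ^ (3 - 1) * deriv (X ∘ ofComplex) τ + 4 * deriv (X ∘ ofComplex) τ = 0 := by
    rw [← hG'.deriv, hG.deriv_eq, deriv_const]
  simp only [Function.comp_apply, ofComplex_apply, Nat.cast_ofNat, show (2 - 1 : ℕ) = 1 from rfl,
    show (3 - 1 : ℕ) = 2 from rfl, pow_one] at hzero
  rw [hX, deriv_X_sixtyFour τ] at hzero
  have hYne : Y τ ≠ 0 := etaQuotient_ne_zero 64 _ τ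
  have key : 2 * Y τ * (deriv (Y ∘ ofComplex) τ
      + 2 * π * I * etaQuotient 64 (expFn [(4, -2), (8, 8), (16, -2)]) τ
        * (3 * etaQuotient 32 (expFn [(8, -2), (16, 6), (32, -4)]) τ ^ 2 - 4)) = 0 := by
    rw [hY] at hzero ⊢
    linear_combination hzero
  rcases mul_eq_zero.mp key with h | h
  · exact absurd h (mul_ne_zero two_ne_zero hYne)
  · linear_combination h

/-! ## §3 (S2)₆₄: `Λ(φ₆₄) ⊆ Λ(16, 0)`, the Néron lattice of `64a1 = [0, 0, 0, −4, 0]` -/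

/-- `φ₆₄ ≠ 0` as a cusp form (an `η`-quotient vanishes nowhere on `ℍ`). [folklore] -/
theorem phi64_ne_zero :
    etaQuotientCuspForm 64 (expFn [(4, -2), (8, 8), (16, -2)]) 2 even_two
        NewformSixtyFour.newmanCond_phi64' NewformSixtyFour.etaCert_sixtyFour.2.2.2.2 ≠ 0 := by
  intro h
  have h1 := congrArg (fun f : CuspForm (Gamma0 64) 2 ↦ f UpperHalfPlane.I) h
  simp only [coe_etaQuotientCuspForm, CuspForm.zero_apply] at h1
  exact etaQuotient_ne_zero 64 _ _ h1

/-- `X` is `Γ₀(64)`-invariant (`Γ₀(64) ≤ Γ₀(32)`). [folklore] -/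
theorem X_smul64 (γ : Gamma0 64) (τ : ℍ) :
    etaQuotient 32 (expFn [(8, -2), (16, 6), (32, -4)]) ((γ : SL(2, ℤ)) • τ)
      = etaQuotient 32 (expFn [(8, -2), (16, 6), (32, -4)]) τ := by
  have hγ : (γ : SL(2, ℤ)) ∈ Gamma0 32 := by
    have h := γ.2
    rw [Gamma0_mem] at h ⊢
    have h64 : (64 : ℤ) ∣ (γ : SL(2, ℤ)) 1 0 := (ZMod.intCast_zmod_eq_zero_iff_dvd _ 64).mp h
    exact (ZMod.intCast_zmod_eq_zero_iff_dvd _ 32).mpr (dvd_trans ⟨2, by norm_num⟩ h64)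
  exact X_smul ⟨_, hγ⟩ τ

/-- Non-degeneracy: `4X³ − 16X ≠ 0` somewhere (else `X² = 4` everywhere, contradicting `X q² → 1`). [folklore] -/
theorem exists_X_nondegenerate64 :
    ∃ τ₀ : ℍ, 4 * etaQuotient 32 (expFn [(8, -2), (16, 6), (32, -4)]) τ₀ ^ 3
      - 16 * etaQuotient 32 (expFn [(8, -2), (16, 6), (32, -4)]) τ₀ - 0 ≠ 0 := by
  by_contra hne
  push Not at hne
  set x : ℍ → ℂ := etaQuotient 32 (expFn [(8, -2), (16, 6), (32, -4)]) with hx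
  have hx2 : ∀ τ : ℍ, x τ ^ 2 = 4 := by
    intro τ
    have h0 : x τ * (x τ ^ 2 - 4) = 0 := by linear_combination (1 / 4 : ℂ) * hne τ
    rcases mul_eq_zero.mp h0 with h | h
    · exact absurd h (etaQuotient_ne_zero 32 _ τ)
    · linear_combination h
  have h1 : Tendsto (fun τ : ℍ ↦ (x τ * Function.Periodic.qParam 1 (τ : ℂ) ^ (2 : ℤ)) ^ 2) atImInfty
      (𝓝 1) := by simpa using tendsto_X_mul_qParam_sq.pow 2
  have h2 : Tendsto (fun τ : ℍ ↦ (x τ * Function.Periodic.qParam 1 (τ : ℂ) ^ (2 : ℤ)) ^ 2) atImInfty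
      (𝓝 0) := by
    have h4 := (tendsto_qParam_zpow_atImInfty (m := 4) (by norm_num)).const_mul (4 : ℂ)
    rw [mul_zero] at h4
    refine h4.congr fun τ ↦ ?_
    rw [mul_pow, hx2, ← zpow_natCast, ← zpow_mul]
    norm_num
  exact one_ne_zero (tendsto_nhds_unique h1 h2)

/-- **(S2)₆₄ unconditionally: the period lattice of `φ₆₄ = η(8τ)⁸/(η(4τ)²η(16τ)²)` lies in the lattice with invariants
`g₂ = 16 = c₄(64a1)/12`, `g₃ = 0 = c₆(64a1)/216`** (analytic bridge with `(X′)² = (2πiφ₆₄)²(4X³ − 16X)` from (I1)₆₄, (I2a)₆₄).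
[cite: CremonaAlgorithms1997, §2.10] -/
theorem periodLatticeLe_sixtyFour :
    ∃ L₁ : PeriodPair, L₁.g₂ = 16 ∧ L₁.g₃ = 0 ∧
      ∀ z ∈ periodLattice (etaQuotientCuspForm 64 (expFn [(4, -2), (8, 8), (16, -2)]) 2 even_two
        NewformSixtyFour.newmanCond_phi64' NewformSixtyFour.etaCert_sixtyFour.2.2.2.2), z ∈ L₁.lattice := by
  obtain ⟨L₁, hg2, hg3⟩ := PeriodPair.uniformization_holds 16 0 (by norm_num)
  refine ⟨L₁, hg2, hg3, periodLattice_le_of_deriv_sq _ phi64_ne_zero L₁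
    (etaQuotient 32 (expFn [(8, -2), (16, 6), (32, -4)])) (mdifferentiable_etaQuotient 32 _)
    X_smul64 ?_ (by rw [hg2, hg3]; exact exists_X_nondegenerate64)⟩
  intro τ
  rw [deriv_X_sixtyFour τ, hg2, hg3, coe_etaQuotientCuspForm]
  linear_combination 4 * (2 * π * I * etaQuotient 64 (expFn [(4, -2), (8, 8), (16, -2)]) τ) ^ 2 * cubic_sixtyFour τ

end Summit.BirchSwinnertonDyer.BirchSwinnertonDyer.Theorems.ManinLocalTwoThree.EtaIdentitiesSixtyFour

end
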